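/-
Copyright (c) 2026. All rights reserved.
Released under Apache 2.0 license as described in the file LICENSE.
Authors: HodgeCM publication cell (pub-hodgecm), DAG-node prover lineage #13 (gen 4: statements and proofs;
gen 7: tree port).
-/
import Literature.RepresentationTheory.HeisenbergGroup.DilationRepresentation
import Literature.RepresentationTheory.HeisenbergGroup.SchrodingerSystem

/-!
# Rigidity of the Levi action: a unitary representation normalising the Schrödinger system as the Levi does
# IS the dilation representation, up to a unique unitary character

Topic `RepresentationTheory/HeisenbergGroup`; namespace `Literature.RepresentationTheory.HeisenbergGroup.SchrodingerLevi`.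

Source.  C. Mœglin, M.-F. Vignéras, J.-L. Waldspurger, *Correspondances de Howe sur un corps p-adique*, LNM 1291
(1987) [MoeglinVignerasWaldspurger1987], Chap. 2 (held text `book:moeglinnd-correspondances-de-howe-sur-un-corps-p`):
II.1 (A) (chunk p0035 L3) — for `g ∈ Sp(W)` the operator `M = M_ψ[g]` of the Weil (metaplectic) representation is
any `M ∈ GL(S)` with "`M ρ_ψ(h) M⁻¹ = ρ_ψ(gh)`, pour tout `h ∈ H`.  De plus `M` est unique à un scalaire près" (by
the irreducibility half of the Stone–von Neumann theorem, I.2, chunk p0030 L3); II.6 (chunk p0041 L14) — in the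
Schrödinger model of a complete polarisation `W = X + X*`, for `a ∈ GL(X)` and `g = diag(a, a*⁻¹)`,
"`M[g]f(x*) = |det_X a|^{1/2} f(a* x*)`".  The Levi element acts on the Heisenberg group `H(X ⊕ X*)` through
`(x, x*) ↦ (a x, a*⁻¹ x*)`, i.e. it conjugates a translation to a translation and a character modulation to a
character modulation.

WHAT IS REPRODUCED (kernel proofs from Mathlib and the two sibling files only), over a locally compact abelian
group `X` with additive Haar measure `μ` and a commutative group `G` acting on `X` distributively and continuously:
* §1 ABSTRACT SCHUR RIGIDITY `exists_character_of_conj_eq`: if a family `𝓢` of self-maps of a complex normed space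
  `E ≠ 0` has scalar commutant (`HasScalarCommutant E 𝓢`) and two unitary representations `T, ω : G →* (E ≃ₗᵢ[ℂ] E)`
  conjugate every member of `𝓢` to the same map, then `ω(g) = ν(g) • T(g)` for a unitary character `ν : G →* S¹`
  — MVW's "unique à un scalaire près" with the scalars assembled into a CHARACTER;
* §2 the Levi conjugation formulas `dilationRep_translate : ω(g) τ_x = τ_{g⁻¹ • x} ω(g)` and
  `dilationRep_modulate : ω(g) M_c = M_{c ∘ (g • ·)} ω(g)` for the dilation representation of
  `DilationRepresentation.lean` ([MVW II.6]);
* §3 `schrodingerSystem μ 𝓜` (all translations and the modulations from `𝓜 ⊆ C(X, S¹)`) and the headline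
  `weilLevi_eq_dilationRep` / `weilLevi_existsUnique`: a unitary representation `ω` of `G` on `L²(X, μ)` normalising
  the Schrödinger system of `𝓜` as the Levi does, the system having scalar commutant (HYPOTHESIS `hirr`, discharged
  for totally disconnected `X` in `StoneVonNeumann.lean`), equals `dilationRep μ ν` for a UNIQUE unitary character
  `ν`; corollary `weilLevi_inner_indicator : ⟪𝟙_A, ω(g) 𝟙_A⟫ = ν(g) δ(g)^{1/2} μ(A ∩ g⁻¹A)`;
* §4 the instance `G = Fˣ`, `X = Fⁿ` over a normed field with compact closed balls — a local field, or `ℝ`, `ℂ`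
  (`splitPlace_weilLevi`): `φ ↦ ν(y) |y|^{n/2} φ(y ·)` is forced.

NOT here: the Stone–von Neumann theorem itself (`StoneVonNeumann*.lean`), the rest of `Sp(W)` (Weyl elements,
the cocycle), smooth models.

Provenance: tree port (LEAN-IN-TREE, 2026-08-18) of §1, §2.4, §3, §4 of the HodgeCM publication cell's package
file `HodgeCM/PerL34/LocalFactors/SchrodingerLevi.lean` (unit `pub-hodgecm-pv13-g4`, gate run 27; statements and
proofs verbatim, namespace `HodgeCM.PerL34.LocalFactors.SchrodingerLevi` ↦
`Literature.RepresentationTheory.HeisenbergGroup.SchrodingerLevi`; one problem-side corollary in an "identity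
intertwiner" currency is not ported).
-/

set_option autoImplicit false

noncomputable section

open MeasureTheory MeasureTheory.Measure Set Complex
open scoped ENNReal NNReal Pointwise InnerProductSpace

namespace Literature.RepresentationTheory.HeisenbergGroup.SchrodingerLevi

open DilationModel

/-! ## §1 Abstract Schur rigidity: two representations normalising an irreducible family alike differ by a
unitary character -/

section Rigidity

variable {G : Type*} [Group G] {E : Type*} [NormedAddCommGroup E] [NormedSpace ℂ E]

variable (E) in
/-- **Scalar commutant** of a family `𝓢` of self-maps of `E`: every bounded `ℂ`-linear operator commuting with
each member of `𝓢` is a scalar.  (For `𝓢` = the Schrödinger system this is the irreducibility half of the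
Stone–von Neumann theorem.) [cite: MoeglinVignerasWaldspurger1987, Chap. 2 I.2] -/
def HasScalarCommutant (𝓢 : Set (E → E)) : Prop :=
  ∀ A : E →L[ℂ] E, (∀ S ∈ 𝓢, ∀ v, A (S v) = S (A v)) → ∃ a : ℂ, ∀ v, A v = a • v

/-- "`M` est unique à un scalaire près" — two unitaries conjugating every member of an irreducible family to the
same map differ by a scalar. [cite: MoeglinVignerasWaldspurger1987, Chap. 2 II.1 (A)] -/
theorem exists_scalar_of_conj_eq (𝓢 : Set (E → E)) (hirr : HasScalarCommutant E 𝓢)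
    (T ω : E ≃ₗᵢ[ℂ] E)
    (h : ∀ S ∈ 𝓢, ∃ S' : E → E, (∀ v, T (S v) = S' (T v)) ∧ ∀ v, ω (S v) = S' (ω v)) :
    ∃ a : ℂ, ∀ v, ω v = a • T v := by
  -- `A = T⁻¹ ∘ ω` commutes with `𝓢`
  set A : E →L[ℂ] E :=
    (T.symm.toLinearIsometry.toContinuousLinearMap).comp ω.toLinearIsometry.toContinuousLinearMap with hA
  have hA_apply : ∀ v, A v = T.symm (ω v) := fun v => rfl
  have hcomm : ∀ S ∈ 𝓢, ∀ v, A (S v) = S (A v) := by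
    intro S hS v
    obtain ⟨S', hT, hω⟩ := h S hS
    apply T.injective
    rw [hA_apply, hA_apply, LinearIsometryEquiv.apply_symm_apply, hω, hT, LinearIsometryEquiv.apply_symm_apply]
  obtain ⟨a, ha⟩ := hirr A hcomm
  refine ⟨a, fun v => ?_⟩
  have := ha v
  rw [hA_apply] at this
  rw [← T.apply_symm_apply (ω v), this, map_smul]

/-- **Abstract Schur rigidity.**  `E ≠ 0`; `𝓢` a family of self-maps of `E` with scalar commutant; `T, ω` two
unitary representations of `G` on `E` such that, for every `g`, `T(g)` and `ω(g)` conjugate each member of `𝓢` to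
the same map.  Then `ω(g) = ν(g) • T(g)` for a unitary character `ν : G →* Circle`.
[cite: MoeglinVignerasWaldspurger1987, Chap. 2 II.1 (A)] -/
theorem exists_character_of_conj_eq [Nontrivial E] (𝓢 : Set (E → E)) (hirr : HasScalarCommutant E 𝓢)
    (T ω : G →* (E ≃ₗᵢ[ℂ] E))
    (h : ∀ g, ∀ S ∈ 𝓢, ∃ S' : E → E, (∀ v, T g (S v) = S' (T g v)) ∧ ∀ v, ω g (S v) = S' (ω g v)) :
    ∃ ν : G →* Circle, ∀ g v, ω g v = (ν g : ℂ) • T g v := by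
  choose a ha using fun g => exists_scalar_of_conj_eq 𝓢 hirr (T g) (ω g) (h g)
  obtain ⟨v₀, hv₀⟩ := exists_ne (0 : E)
  -- `|a g| = 1`
  have hnorm : ∀ g, ‖a g‖ = 1 := by
    intro g
    have h1 : ‖ω g v₀‖ = ‖a g‖ * ‖v₀‖ := by
      rw [ha g v₀, norm_smul, LinearIsometryEquiv.norm_map]
    rw [LinearIsometryEquiv.norm_map] at h1
    have hv : ‖v₀‖ ≠ 0 := norm_ne_zero_iff.2 hv₀
    field_simp [hv] at h1
    exact h1.symm
  -- `a` is multiplicative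
  have hmul : ∀ g g', a (g * g') = a g * a g' := by
    intro g g'
    have hne : T (g * g') v₀ ≠ 0 := (map_ne_zero_iff _ (T (g * g')).injective).2 hv₀
    have e1 : ω (g * g') v₀ = (a g * a g') • T (g * g') v₀ := by
      rw [map_mul, map_mul, LinearIsometryEquiv.coe_mul, Function.comp_apply, ha g', map_smul, ha g,
        smul_smul, LinearIsometryEquiv.coe_mul, Function.comp_apply, mul_comm]
    have e2 : ω (g * g') v₀ = a (g * g') • T (g * g') v₀ := ha (g * g') v₀
    exact smul_left_injective ℂ hne (e2.symm.trans e1)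
  refine ⟨MonoidHom.mk' (fun g => ⟨a g, mem_sphere_zero_iff_norm.2 (hnorm g)⟩)
    (fun g g' => Circle.ext (by simp [hmul])), fun g v => ?_⟩
  simpa using ha g v

end Rigidity

/-! ## §2 Conjugation by the dilation representation: `dilationRep μ ν` normalises the Schrödinger system as the
Levi element does (`a ∈ GL(X)` acts on `H(X ⊕ X*)` through `(x, x*) ↦ (a x, a*⁻¹ x*)`) -/

section Levi

variable {G : Type*} [CommGroup G] {X : Type*} [AddCommGroup X] [DistribMulAction G X]
  [TopologicalSpace X] [IsTopologicalAddGroup X] [LocallyCompactSpace X] [ContinuousConstSMul G X]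
  [MeasurableSpace X] [BorelSpace X] (μ : Measure X) [μ.IsAddHaarMeasure] [μ.Regular]

/-- `dilationRep μ ν g = ν(g) • dilationRep μ 1 g` pointwise: the character is a scalar factor. [folklore] -/
theorem dilationRep_apply_eq_smul (ν : G →* Circle) (g : G) (f : Lp ℂ 2 μ) :
    dilationRep μ ν g f = (ν g : ℂ) • dilationRep μ 1 g f := by
  apply Lp.ext
  refine (coeFn_dilationRep μ ν g f).trans (Filter.EventuallyEq.trans ?_ (Lp.coeFn_smul _ _).symm)
  filter_upwards [coeFn_dilationRep μ 1 g f] with u hu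
  rw [Pi.smul_apply, hu, smul_eq_mul, ← mul_assoc]
  congr 1
  simp only [weight, MonoidHom.one_apply, Circle.coe_one, one_mul]

/-- **`ω(g) τ_x = τ_{g⁻¹ • x} ω(g)`** — the dilation conjugates a translation to a translation.
[cite: MoeglinVignerasWaldspurger1987, Chap. 2 II.6] -/
theorem dilationRep_translate (ν : G →* Circle) (g : G) (x : X) (f : Lp ℂ 2 μ) :
    dilationRep μ ν g (translate μ x f) = translate μ (g⁻¹ • x) (dilationRep μ ν g f) := by
  apply Lp.ext
  refine (coeFn_dilationRep μ ν g _).trans (Filter.EventuallyEq.trans ?_ (coeFn_translate μ _ _).symm)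
  have h1 := (quasiMeasurePreserving_smul' μ g).ae_eq_comp (coeFn_translate μ x f)
  have h2 := (measurePreserving_add_right μ (g⁻¹ • x)).quasiMeasurePreserving.ae_eq_comp
    (coeFn_dilationRep μ ν g f)
  filter_upwards [h1, h2] with u hu1 hu2
  simp only [Function.comp_apply] at hu1 hu2
  rw [hu1, hu2, smul_add, smul_inv_smul]

/-- **`ω(g) M_c = M_{c ∘ (g • ·)} ω(g)`** — the dilation conjugates a modulation to a modulation.
[cite: MoeglinVignerasWaldspurger1987, Chap. 2 II.6] -/
theorem dilationRep_modulate (ν : G →* Circle) (g : G) (c : C(X, Circle)) (f : Lp ℂ 2 μ) :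
    dilationRep μ ν g (modulate μ c f) = modulate μ (c.comp (smulMap g)) (dilationRep μ ν g f) := by
  apply Lp.ext
  refine (coeFn_dilationRep μ ν g _).trans (Filter.EventuallyEq.trans ?_ (coeFn_modulate μ _ _).symm)
  have h1 := (quasiMeasurePreserving_smul' μ g).ae_eq_comp (coeFn_modulate μ c f)
  filter_upwards [h1, coeFn_dilationRep μ ν g f] with u hu1 hu2
  simp only [Function.comp_apply] at hu1
  rw [hu1, hu2, ContinuousMap.comp_apply, smulMap_apply]
  ring

end Levi

/-! ## §3 The headline: a Weil representation on the Siegel Levi IS the dilation representation, up to a unique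
unitary character -/

section Headline

variable {G : Type*} [CommGroup G] {X : Type*} [AddCommGroup X] [DistribMulAction G X]
  [TopologicalSpace X] [IsTopologicalAddGroup X] [LocallyCompactSpace X] [ContinuousConstSMul G X]
  [MeasurableSpace X] [BorelSpace X] (μ : Measure X) [μ.IsAddHaarMeasure] [μ.Regular]

/-- **The Schrödinger system** of a family `𝓜 ⊆ C(X, S¹)` of multipliers: all translations `τ_x`, `x ∈ X`, and
the modulations `M_c`, `c ∈ 𝓜`.  For `𝓜` = the unitary characters `u ↦ ψ(⟨u, ξ⟩)`, `ξ ∈ X*`, this is the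
Schrödinger representation `ρ_ψ` of the Heisenberg group `H(X ⊕ X*)` on `L²(X)`, up to its central scalars.
[cite: MoeglinVignerasWaldspurger1987, Chap. 2 I.4 Ex. (1)] -/
def schrodingerSystem (𝓜 : Set C(X, Circle)) : Set (Lp ℂ 2 μ → Lp ℂ 2 μ) :=
  Set.range (fun x : X => ⇑(translate μ x)) ∪ (fun c : C(X, Circle) => ⇑(modulate μ c)) '' 𝓜

omit [IsTopologicalAddGroup X] [μ.Regular] in
/-- `L²(X, μ) ≠ 0`: the indicator of the interior of a compact neighbourhood of `0` is a non-zero vector.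
[folklore] -/
theorem exists_ne_zero : ∃ f : Lp ℂ 2 μ, f ≠ 0 := by
  obtain ⟨K, hK, hK0⟩ := exists_compact_mem_nhds (0 : X)
  have hpos : μ (interior K) ≠ 0 :=
    (isOpen_interior.measure_pos μ ⟨0, mem_interior_iff_mem_nhds.2 hK0⟩).ne'
  have htop : μ (interior K) ≠ ⊤ := ((measure_mono interior_subset).trans_lt hK.measure_lt_top).ne
  refine ⟨indicatorConstLp 2 isOpen_interior.measurableSet htop (1 : ℂ), ?_⟩
  rw [← norm_ne_zero_iff, norm_indicatorConstLp two_ne_zero ENNReal.ofNat_ne_top, norm_one, one_mul]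
  exact (Real.rpow_pos_of_pos (ENNReal.toReal_pos hpos htop) _).ne'

omit [IsTopologicalAddGroup X] [μ.Regular] in
/-- `L²(X, μ)` is a non-trivial space. [folklore] -/
theorem nontrivial_Lp : Nontrivial (Lp ℂ 2 μ) :=
  let ⟨f, hf⟩ := exists_ne_zero μ
  ⟨⟨f, 0, hf⟩⟩

/-- the character of a dilation representation is determined by the representation. [folklore] -/
theorem dilationRep_injective : Function.Injective (dilationRep μ : (G →* Circle) → _) := by
  intro ν ν' h
  ext g
  obtain ⟨f, hf⟩ := exists_ne_zero μ
  have hne : dilationRep μ 1 g f ≠ 0 := (map_ne_zero_iff _ (dilationRep μ 1 g).injective).2 hf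
  have key : dilationRep μ ν g f = dilationRep μ ν' g f := by rw [h]
  rw [dilationRep_apply_eq_smul μ ν, dilationRep_apply_eq_smul μ ν'] at key
  exact congrArg _ (Circle.ext (smul_left_injective ℂ hne key))

/-- **Rigidity of the Levi action — the Weil representation on the Siegel Levi.**
Let `ω : G →* U(L²(X, μ))` be a unitary representation normalising the Schrödinger system of `𝓜` EXACTLY AS THE
LEVI ELEMENT DOES: `ω(g) τ_x = τ_{g⁻¹ • x} ω(g)` and `ω(g) M_c = M_{c ∘ (g • ·)} ω(g)` for `c ∈ 𝓜` — the defining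
property `M ρ_ψ(h) M⁻¹ = ρ_ψ(gh)` of the Weil representation, restricted to the Levi of the polarisation `X ⊕ X*`.
If the Schrödinger system of `𝓜` has scalar commutant (Stone–von Neumann irreducibility — the hypothesis `hirr`),
then `ω` IS the dilation representation `dilationRep μ ν`, `(ω(g) f)(u) = ν(g) δ(g)^{1/2} f(g • u)`, for a unitary
character `ν : G →* S¹` — MVW II.6's `|det_X a|^{1/2}` (`= δ^{1/2}`) being forced by unitarity.
[cite: MoeglinVignerasWaldspurger1987, Chap. 2 II.1 (A), II.6] -/
theorem weilLevi_eq_dilationRep (𝓜 : Set C(X, Circle))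
    (hirr : HasScalarCommutant (Lp ℂ 2 μ) (schrodingerSystem μ 𝓜))
    (ω : G →* (Lp ℂ 2 μ ≃ₗᵢ[ℂ] Lp ℂ 2 μ))
    (hτ : ∀ (g : G) (x : X) (f : Lp ℂ 2 μ), ω g (translate μ x f) = translate μ (g⁻¹ • x) (ω g f))
    (hM : ∀ (g : G), ∀ c ∈ 𝓜, ∀ f : Lp ℂ 2 μ,
      ω g (modulate μ c f) = modulate μ (c.comp (smulMap g)) (ω g f)) :
    ∃ ν : G →* Circle, ω = dilationRep μ ν := by
  haveI : Nontrivial (Lp ℂ 2 μ) := nontrivial_Lp μ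
  obtain ⟨ν, hν⟩ := exists_character_of_conj_eq (schrodingerSystem μ 𝓜) hirr (dilationRep μ 1) ω
    (fun g S hS => by
      rcases hS with ⟨x, rfl⟩ | ⟨c, hc, rfl⟩
      · exact ⟨⇑(translate μ (g⁻¹ • x)), fun v => dilationRep_translate μ 1 g x v, fun v => hτ g x v⟩
      · exact ⟨⇑(modulate μ (c.comp (smulMap g))), fun v => dilationRep_modulate μ 1 g c v,
          fun v => hM g c hc v⟩)
  refine ⟨ν, MonoidHom.ext fun g => LinearIsometryEquiv.ext fun f => ?_⟩
  rw [hν, dilationRep_apply_eq_smul μ ν g f]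

/-- **… and the unitary character is UNIQUE** ("up to a unitary character", sharpened).
[cite: MoeglinVignerasWaldspurger1987, Chap. 2 II.1 (A), II.6] -/
theorem weilLevi_existsUnique (𝓜 : Set C(X, Circle))
    (hirr : HasScalarCommutant (Lp ℂ 2 μ) (schrodingerSystem μ 𝓜))
    (ω : G →* (Lp ℂ 2 μ ≃ₗᵢ[ℂ] Lp ℂ 2 μ))
    (hτ : ∀ (g : G) (x : X) (f : Lp ℂ 2 μ), ω g (translate μ x f) = translate μ (g⁻¹ • x) (ω g f))
    (hM : ∀ (g : G), ∀ c ∈ 𝓜, ∀ f : Lp ℂ 2 μ,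
      ω g (modulate μ c f) = modulate μ (c.comp (smulMap g)) (ω g f)) :
    ∃! ν : G →* Circle, ω = dilationRep μ ν := by
  obtain ⟨ν, hν⟩ := weilLevi_eq_dilationRep μ 𝓜 hirr ω hτ hM
  exact ⟨ν, hν, fun ν' hν' => dilationRep_injective μ (hν'.symm.trans hν)⟩

/-- **the matrix coefficient at every indicator vector**, for the ACTUAL `ω`, not a model of it:
`⟪𝟙_A, ω(g) 𝟙_A⟫ = ν(g) δ(g)^{1/2} μ(A ∩ g⁻¹A)` for every measurable `A` of finite measure
(`DilationModel.inner_indicator_dilationRep` transported along `weilLevi_eq_dilationRep`). [folklore] -/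
theorem weilLevi_inner_indicator (𝓜 : Set C(X, Circle))
    (hirr : HasScalarCommutant (Lp ℂ 2 μ) (schrodingerSystem μ 𝓜))
    (ω : G →* (Lp ℂ 2 μ ≃ₗᵢ[ℂ] Lp ℂ 2 μ))
    (hτ : ∀ (g : G) (x : X) (f : Lp ℂ 2 μ), ω g (translate μ x f) = translate μ (g⁻¹ • x) (ω g f))
    (hM : ∀ (g : G), ∀ c ∈ 𝓜, ∀ f : Lp ℂ 2 μ,
      ω g (modulate μ c f) = modulate μ (c.comp (smulMap g)) (ω g f)) :
    ∃ ν : G →* Circle, ∀ (g : G) {A : Set X} (hA : MeasurableSet A) (hμA : μ A ≠ ⊤),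
      ⟪indicatorConstLp 2 hA hμA (1 : ℂ), ω g (indicatorConstLp 2 hA hμA (1 : ℂ))⟫_ℂ
        = weight X ν g * (μ.real (A ∩ (fun x => g • x) ⁻¹' A) : ℂ) := by
  obtain ⟨ν, hν⟩ := weilLevi_eq_dilationRep μ 𝓜 hirr ω hτ hM
  exact ⟨ν, fun g A hA hμA => by rw [hν]; exact inner_indicator_dilationRep μ ν g hA hμA⟩

end Headline

/-! ## §4 The instance `G = Fˣ`, `X = Fⁿ` over a normed field with compact closed balls (a local field; also `ℝ`, `ℂ`) -/

section SplitPlace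

variable {F : Type} [NormedField F] [ProperSpace F] {n : ℕ}
  [MeasurableSpace (Fin n → F)] [BorelSpace (Fin n → F)] (μV : Measure (Fin n → F)) [μV.IsAddHaarMeasure]

/-- **The Levi action on `L²(Fⁿ)` is forced.**  A unitary representation `ω` of `Fˣ` on `L²(Fⁿ)` normalising the
Schrödinger system as the Levi `y ↦ diag(y, y⁻¹)` does (`ω(y) τ_x = τ_{y⁻¹x} ω(y)`, `ω(y) M_c = M_{c(y·)} ω(y)`),
the system being irreducible (Stone–von Neumann, hypothesis `hirr`), is `φ ↦ ν(y)|y|^{n/2}φ(y·)` for a unique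
unitary character `ν` of `Fˣ`. [cite: MoeglinVignerasWaldspurger1987, Chap. 2 II.1 (A), II.6] -/
theorem splitPlace_weilLevi (𝓜 : Set C(Fin n → F, Circle))
    (hirr : HasScalarCommutant (Lp ℂ 2 μV) (schrodingerSystem μV 𝓜))
    (ω : Fˣ →* (Lp ℂ 2 μV ≃ₗᵢ[ℂ] Lp ℂ 2 μV))
    (hτ : ∀ (y : Fˣ) (x : Fin n → F) (f : Lp ℂ 2 μV),
      ω y (translate μV x f) = translate μV (y⁻¹ • x) (ω y f))
    (hM : ∀ (y : Fˣ), ∀ c ∈ 𝓜, ∀ f : Lp ℂ 2 μV,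
      ω y (modulate μV c f) = modulate μV (c.comp (smulMap y)) (ω y f)) :
    ∃! ν : Fˣ →* Circle, ω = dilationRep μV ν :=
  weilLevi_existsUnique μV 𝓜 hirr ω hτ hM

end SplitPlace

end Literature.RepresentationTheory.HeisenbergGroup.SchrodingerLevi
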